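import Summits.Ventures.PercRepro.MSTightTopMember

/-!
# The required cells of a near-member in the product coordinates of a tight family

Dossier proofs/MINE1-theoremS.md, Addendum 67 (the product coordinates). Let `F` be tight,
`M := Rstar F` (the addable part, the top member), `N := univ \ M`, and let `L := within D N`,
`L' := within D M` be the two factors of the difference family `D := F \\ F = L ⊻ L'`
(Theorem S, `flip_eq_sups_within_of_tight` + `diffs_eq_flip_of_tight`); every member is
`X ∪ (M \ Y)` with `X ∈ L`, `Y ∈ L'` (`tight_eq_sups_of_tight`). For a twin-closed set `u` the
four cells of `u` at the member `X ∪ (M \ Y)` are «mixed»: each is the union of an `N`-cell of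
`(X, u ∩ N)` and an `M`-cell of `(Y, M \ u)`, and it is a difference iff both sides lie in their
factor; one side is automatic because the factors are class-down-sets. Hence:

* agreement cells: `Cells D (X ∪ (M \ Y)) u ↔ (u ∩ M) \ Y ∈ L' ∧ N \ (X ∪ u) ∈ L`
  (`cells_iff_of_tight`);
* disagreement cells: `Cells D (X ∪ (M \ Y)) (univ \ u) ↔ M \ (Y ∪ u) ∈ L' ∧ (u ∩ N) \ X ∈ L`
  (`cells_compl_iff_of_tight`).

These are the formulas behind the tight regime of (Θ) (the transversal `A ∪ C*` tight, any number
of pairs of the middle type): a defect cell has exactly one bad side, and the top member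
`X = Y = ∅` gives Theorem (TL) directly (`MSTightTopMember.lean`).
-/

namespace PercRepro.MSTight

open Finset
open scoped FinsetFamily

variable {α : Type*} [DecidableEq α] [Fintype α]

section Product

variable {F : Finset (Finset α)}

omit [Fintype α] in
/-- Membership in a product of families living on disjoint supports is decided factor-wise. -/
theorem union_mem_sups_iff {G : Finset (Finset α)} {N M' : Finset α} (hNM : Disjoint N M')
    {Z Z' : Finset α} (hZ : Z ⊆ N) (hZ' : Z' ⊆ M') :
    Z ∪ Z' ∈ within G N ⊻ within G M' ↔ Z ∈ within G N ∧ Z' ∈ within G M' := by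
  constructor
  · intro h
    obtain ⟨a, ha, b, hb, hab⟩ := mem_sups.1 h
    rw [sup_eq_union] at hab
    obtain ⟨haG, haN⟩ := mem_within.1 ha
    obtain ⟨hbG, hbM⟩ := mem_within.1 hb
    have key : ∀ {P Q : Finset α}, P ⊆ N → Q ⊆ M' → (P ∪ Q) ∩ N = P := by
      intro P Q hP hQ
      ext x; simp only [mem_inter, mem_union]
      constructor
      · rintro ⟨hx | hx, hxN⟩
        · exact hx
        · exact absurd hxN (Finset.disjoint_right.1 hNM (hQ hx))
      · exact fun hx => ⟨Or.inl hx, hP hx⟩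
    have key' : ∀ {P Q : Finset α}, P ⊆ N → Q ⊆ M' → (P ∪ Q) ∩ M' = Q := by
      intro P Q hP hQ
      ext x; simp only [mem_inter, mem_union]
      constructor
      · rintro ⟨hx | hx, hxM⟩
        · exact absurd hxM (Finset.disjoint_left.1 hNM (hP hx))
        · exact hx
      · exact fun hx => ⟨Or.inr hx, hQ hx⟩
    have e1 : Z = a := by rw [← key hZ hZ', ← hab, key haN hbM]
    have e2 : Z' = b := by rw [← key' hZ hZ', ← hab, key' haN hbM]
    rw [e1, e2]
    exact ⟨ha, hb⟩
  · rintro ⟨h1, h2⟩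
    exact mem_sups.2 ⟨Z, h1, Z', h2, sup_eq_union⟩

/-- The difference family of a tight family is the product of its two factors. -/
theorem diffs_eq_sups_within_of_tight (hF : Tight F) :
    F \\ F = within (F \\ F) (univ \ Rstar F) ⊻ within (F \\ F) (Rstar F) := by
  have h := flip_eq_sups_within_of_tight hF
  rw [← diffs_eq_flip_of_tight hF] at h
  exact h

/-- A twin-closed part of an element of a factor stays in the factor. -/
theorem inter_mem_within_of_twinClosed (hF : Tight F) {S Z W : Finset α}
    (hZ : Z ∈ within (F \\ F) S) (hW : TwinClosed F W) : Z ∩ W ∈ within (F \\ F) S := by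
  obtain ⟨hZD, hZS⟩ := mem_within.1 hZ
  exact mem_within.2 ⟨inter_mem_diffs_of_twinClosed hF hZD hW, inter_subset_left.trans hZS⟩

/-- Removing a twin-closed set from an element of a factor stays in the factor. -/
theorem sdiff_mem_within_of_twinClosed (hF : Tight F) {S Z W : Finset α}
    (hZ : Z ∈ within (F \\ F) S) (hW : TwinClosed F W) : Z \ W ∈ within (F \\ F) S := by
  obtain ⟨hZD, hZS⟩ := mem_within.1 hZ
  exact mem_within.2 ⟨sdiff_mem_diffs_of_twinClosed hF hZD hW, sdiff_subset.trans hZS⟩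

end Product

section Cells

variable {F : Finset (Finset α)}

/-- **The agreement cells of a twin-closed set at a member, in product coordinates.** For
`X ∈ L`, `Y ∈ L'` (the factors on `N = univ \ Rstar F` and `M = Rstar F`) the two agreement cells
of `u` at the member `X ∪ (M \ Y)` are differences iff `(u ∩ M) \ Y ∈ L'` and
`N \ (X ∪ u) ∈ L`. -/
theorem cells_iff_of_tight (hF : Tight F) {u : Finset α} (hu : TwinClosed F u) {X Y : Finset α}
    (hX : X ∈ within (F \\ F) (univ \ Rstar F)) (hY : Y ∈ within (F \\ F) (Rstar F)) :
    Cells (F \\ F) (X ∪ (Rstar F \ Y)) u ↔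
      (u ∩ Rstar F) \ Y ∈ within (F \\ F) (Rstar F) ∧
        (univ \ Rstar F) \ (X ∪ u) ∈ within (F \\ F) (univ \ Rstar F) := by
  set M := Rstar F with hM
  obtain ⟨-, hXN⟩ := mem_within.1 hX
  obtain ⟨-, hYM⟩ := mem_within.1 hY
  have hD : ∀ Z, Z ∈ F \\ F ↔ Z ∈ within (F \\ F) (univ \ M) ⊻ within (F \\ F) M := fun Z => by
    conv_lhs => rw [diffs_eq_sups_within_of_tight hF]
  have hNM : Disjoint (univ \ M) M := sdiff_disjoint
  -- the first cell
  have e1 : (X ∪ (M \ Y)) ∩ u = (X ∩ u) ∪ ((u ∩ M) \ Y) := by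
    ext x; simp only [mem_inter, mem_union, mem_sdiff]; tauto
  have c1 : (X ∪ (M \ Y)) ∩ u ∈ F \\ F ↔ (u ∩ M) \ Y ∈ within (F \\ F) M := by
    rw [e1, hD, union_mem_sups_iff hNM (inter_subset_left.trans hXN)
      (sdiff_subset.trans inter_subset_right)]
    constructor
    · exact fun h => h.2
    · intro h
      exact ⟨inter_mem_within_of_twinClosed hF hX hu, h⟩
  -- the second cell
  have e2 : (univ \ (X ∪ (M \ Y))) ∩ (univ \ u) = ((univ \ M) \ (X ∪ u)) ∪ (Y \ u) := by
    ext x; simp only [mem_inter, mem_union, mem_sdiff, mem_univ, true_and, not_or, not_and,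
      not_not]
    constructor
    · rintro ⟨⟨hx1, hx2⟩, hx3⟩
      by_cases hxM : x ∈ M
      · exact Or.inr ⟨hx2 hxM, hx3⟩
      · exact Or.inl ⟨hxM, hx1, hx3⟩
    · rintro (⟨hx1, hx2, hx3⟩ | ⟨hx1, hx2⟩)
      · exact ⟨⟨hx2, fun h => absurd h hx1⟩, hx3⟩
      · exact ⟨⟨fun h => (mem_sdiff.1 (hXN h)).2 (hYM hx1), fun _ => hx1⟩, hx2⟩
  have c2 : (univ \ (X ∪ (M \ Y))) ∩ (univ \ u) ∈ F \\ F ↔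
      (univ \ M) \ (X ∪ u) ∈ within (F \\ F) (univ \ M) := by
    rw [e2, hD, union_mem_sups_iff hNM sdiff_subset (sdiff_subset.trans hYM)]
    constructor
    · exact fun h => h.1
    · intro h
      exact ⟨h, sdiff_mem_within_of_twinClosed hF hY hu⟩
  unfold Cells
  rw [c1, c2, and_comm]

/-- **The disagreement cells of a twin-closed set at a member, in product coordinates.** The two
disagreement cells of `u` at the member `X ∪ (M \ Y)` are differences iff `M \ (Y ∪ u) ∈ L'`
and `(u ∩ N) \ X ∈ L`. -/
theorem cells_compl_iff_of_tight (hF : Tight F) {u : Finset α} (hu : TwinClosed F u)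
    {X Y : Finset α} (hX : X ∈ within (F \\ F) (univ \ Rstar F))
    (hY : Y ∈ within (F \\ F) (Rstar F)) :
    Cells (F \\ F) (X ∪ (Rstar F \ Y)) (univ \ u) ↔
      Rstar F \ (Y ∪ u) ∈ within (F \\ F) (Rstar F) ∧
        (u ∩ (univ \ Rstar F)) \ X ∈ within (F \\ F) (univ \ Rstar F) := by
  set M := Rstar F with hM
  obtain ⟨-, hXN⟩ := mem_within.1 hX
  obtain ⟨-, hYM⟩ := mem_within.1 hY
  have hD : ∀ Z, Z ∈ F \\ F ↔ Z ∈ within (F \\ F) (univ \ M) ⊻ within (F \\ F) M := fun Z => by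
    conv_lhs => rw [diffs_eq_sups_within_of_tight hF]
  have hNM : Disjoint (univ \ M) M := sdiff_disjoint
  have e1 : (X ∪ (M \ Y)) ∩ (univ \ u) = (X \ u) ∪ (M \ (Y ∪ u)) := by
    ext x; simp only [mem_inter, mem_union, mem_sdiff, mem_univ, true_and, not_or]; tauto
  have c1 : (X ∪ (M \ Y)) ∩ (univ \ u) ∈ F \\ F ↔ M \ (Y ∪ u) ∈ within (F \\ F) M := by
    rw [e1, hD, union_mem_sups_iff hNM (sdiff_subset.trans hXN) sdiff_subset]
    constructor
    · exact fun h => h.2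
    · intro h
      exact ⟨sdiff_mem_within_of_twinClosed hF hX hu, h⟩
  have e2 : (univ \ (X ∪ (M \ Y))) ∩ (univ \ (univ \ u)) = ((u ∩ (univ \ M)) \ X) ∪ (Y ∩ u) := by
    ext x; simp only [mem_inter, mem_union, mem_sdiff, mem_univ, true_and, not_or, not_and,
      not_not]
    constructor
    · rintro ⟨⟨hx1, hx2⟩, hx3⟩
      by_cases hxM : x ∈ M
      · exact Or.inr ⟨hx2 hxM, hx3⟩
      · exact Or.inl ⟨⟨hx3, hxM⟩, hx1⟩
    · rintro (⟨⟨hx1, hx2⟩, hx3⟩ | ⟨hx1, hx2⟩)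
      · exact ⟨⟨hx3, fun h => absurd h hx2⟩, hx1⟩
      · exact ⟨⟨fun h => (mem_sdiff.1 (hXN h)).2 (hYM hx1), fun _ => hx1⟩, hx2⟩
  have c2 : (univ \ (X ∪ (M \ Y))) ∩ (univ \ (univ \ u)) ∈ F \\ F ↔
      (u ∩ (univ \ M)) \ X ∈ within (F \\ F) (univ \ M) := by
    rw [e2, hD, union_mem_sups_iff hNM (sdiff_subset.trans inter_subset_right)
      (inter_subset_left.trans hYM)]
    constructor
    · exact fun h => h.1
    · intro h
      exact ⟨h, inter_mem_within_of_twinClosed hF hY hu⟩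
  unfold Cells
  rw [c1, c2, and_comm]

end Cells

end PercRepro.MSTight
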